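import Summits.BirchSwinnertonDyer.BirchSwinnertonDyer.Theses.PrintX6
import Summits.BirchSwinnertonDyer.BirchSwinnertonDyer.Theorems.PrintX6KobayashiUpperHalf
import Summits.BirchSwinnertonDyer.Rank1Residual.Supersingular.X6ErrCell130798a1KimTamDefectLocalTorsionTrivial
import HarnessLib

/-!
# Route `PrintX6`, erratum sub-leaf `EisensteinHalfFiveLeErr` (stmt-BirchSwinnertonDyer-21115): the Tam-defect Err cell `(130798a1, p = 7)`
# CLOSED ON THE ROUTE'S TRUST BASE — `BSD(E,7)` from `PublishedInputsX6` (upper half = the PROVED item `UpperHalfX6`) + the flag-free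
# Kurihara-number lower half `X6RankZero.missingLowerBoundAt_cell_130798a1_at7_LT` (proof-covered Kim twin), NO Perrin-Riou Prop. 4.8,
# NO pack `PublishedAcInputsX6Err` (cell `bsd-print-x6`, seat p2 gen 7, PLAN v4.6 TURNKEY P4-A6OPEN (T2) cell C5; `--supports` stmt-21115
# as helper; closes no item)

PARTITION currency (D-0054): ONE cell of the erratum sub-leaf, per pair — the class `130798a` is `residue:X6~` with an EMPTY register on
desk A's book R895 (PLAN v4.6 C5), so this key is offered for +1 class; nothing booked here; BEYOND-PRINT THEOREM: **NO**.
The road of record `Supersingular.bsdp_x6r0tam_130798a1_7` (x10b, `X6KimTamDefectRecordsB`) reads its upper half from Perrin-Riou 2003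
Prop. 4.8 (flag `PR03-Prop4.8-Kato-attribution`) and its lower half from the flagged Kim 2026 fact; here the upper half is the route's
`UpperHalfX6` chain (`X6.missingUpperBoundAt_rankZero_of_thm41`: Kobayashi 2003 Thm 4.1/1.2 + B. D. Kim 2013 Cor 3.15 + period units +
Pollack + modularity + GZK = conjuncts of `PublishedInputsX6`) and the lower half is
`Supersingular.X6RankZero.missingLowerBoundAt_cell_130798a1_at7_LT` (depth-2 Kurihara number at `7253·17837` through
`Kim2026.…_of_localTorsionTrivial`, unflagged). Binders: `PublishedInputsX6`, the Kim twin, the model, and the displayed data of the road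
of record (`r_an = 0`, `2 ≤ ord₇ ∏c + 1`, Manin datum `D` with `7 ∤ c_D`, period transfer, `ψ`, `hδ` — TWO EXACT engines: engine Q kit
j241847 (`δ̃⁽²⁾ ≡ 14 (mod 49)`) and PARI `msfromell` kit j241528, x10b X6-KURIHARA.md §28). `ClassX6 W 7` is derived from the integer model
(`#Ẽ(𝔽₇) = 8`, kernel count inlined — the named count `Theorems.card_c130798a1_7` lives in route SignedLowerHalves' scope file, not
imported here: p557282's dedup lesson). Level-one enclosure for an `hr0`-free variant (optional polish, PLAN v4.6): T₀ = L/ω₁ = 686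
(L/Ω⁺ = 343), planner kit j288041 (PARI) / j288047 (Sage).
References: [Kobayashi2003] Thm 1.2/4.1; [BDKim2013] Cor 3.15; [Kim2022StructureSelmer] Thm 1.9 (6); [Miller2011LMS] Def 1.1;
[Cremona2006] Table 1 (130798a1).
-/

set_option autoImplicit false
set_option linter.dupNamespace false

noncomputable section

open scoped Classical MatrixGroups ModularForm

open CongruenceSubgroup WeierstrassCurve Literature.NumberTheory.EllipticCurves
  Literature.NumberTheory.EllipticCurves.Rank1Residual
  Literature.NumberTheory.EllipticCurves.Rank1Residual.Typed
  Literature.NumberTheory.EllipticCurves.Rank1Residual.X11RankOneCertificates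
  Literature.NumberTheory.EllipticCurves.ModularForms
  Summit.BirchSwinnertonDyer.BirchSwinnertonDyer.Rank1Residual.IntModel
  Summit.BirchSwinnertonDyer.Rank1Residual.X11b
  Summit.BirchSwinnertonDyer.Rank1Residual.Supersingular
  Summit.BirchSwinnertonDyer.BirchSwinnertonDyer.Theses.PrintX6

namespace Summit.BirchSwinnertonDyer.BirchSwinnertonDyer.Theorems.PrintX6

/-- **`BSD(E,7)` for `E = 130798a1` on the route's trust base — no Perrin-Riou Prop. 4.8, no flagged fact, no anticyclotomic pack.** Upper
half: `X6.missingUpperBoundAt_rankZero_of_thm41` from the conjuncts of `PublishedInputsX6`; lower half: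
`X6RankZero.missingLowerBoundAt_cell_130798a1_at7_LT` (depth-2 Kurihara number at `7253·17837` through the proof-covered Kim twin, GZK and
modularity = conjuncts 9 and 8 of the pack); `ClassX6 W 7` from the integer model (`classX6_of_intModel`, kernel point count `#Ẽ(𝔽₇) = 8`
inlined); then `missingPPartAt_of_lower_of_upper` and `bsdp_of_missingPPartAt`. Displayed binders as the road of record
`bsdp_x6r0tam_130798a1_7` minus `h48`/`hKimL` (`hKim` = the UNFLAGGED twin). Per pair; not a class theorem.
[cite: Kobayashi2003, Thm. 4.1 (p. 8) and Thm. 1.2 (p. 2)] [cite: BDKim2013, Cor. 3.15 (p. 199)]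
[cite: Kim2022StructureSelmer, Thm. 1.9 (6) (PDF p. 8)] [cite: Miller2011LMS, §1 and Def. 1.1] [cite: Cremona2006, Table 1 (Cremona label 130798a1)] -/
theorem X6.bsdp_130798a1_at7_of_publishedInputsX6 (hPub : PublishedInputsX6)
    (hKim : Kim2026.rankZero_le_padicValNat_sha_of_kuriharaNumber_ne_zero_of_localTorsionTrivial)
    {W : WeierstrassCurve ℚ} [W.IsElliptic] [W.IsGloballyMinimal]
    (hWeq : W = ⟨1, 1, 1, -1514781218, -22692641927633⟩) (hr0 : W.analyticRank = 0)
    (hkt : 2 ≤ padicValNat 7 W.tamagawaProduct + 1)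
    {N : ℕ} [NeZero N] (D : ModularParametrizationData W N) (hc : ¬ (7 : ℤ) ∣ D.maninConstant)
    (hper : ∃ u : ℚ, ‖(u : ℚ_[7])‖ = 1 ∧ W.realPeriodRat = u * plusPeriod D.f)
    (ψ : (ℓ : ℕ) → (ZMod ℓ)ˣ →* Multiplicative (ZMod (7 ^ 2)))
    (hψ₁ : Function.Surjective (ψ 7253)) (hψ₂ : Function.Surjective (ψ 17837))
    (hδ : kuriharaNumber D.f (7 ^ 2) (7253 * 17837) ψ ≠ 0) : BSDp W 7 := by
  haveI : Fact (Nat.Prime 7) := ⟨by norm_num⟩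
  obtain ⟨h12, h41, hKim315, hϖ, h3, -, hmod, hmod', hGZK⟩ := hPub
  have hIW : integralModelInt W = ⟨1, 1, 1, -1514781218, -22692641927633⟩ :=
    integralModelInt_eq_of_map_eq _ (by rw [hWeq]; ext <;> simp [WeierstrassCurve.map])
  have hX : ClassX6 W 7 :=
    classX6_of_intModel 7 (by norm_num) hIW (by decide +kernel)
      (natCard_point_eq_of_countPoints 1 1 1 (-1514781218) (-22692641927633) 7 (by norm_num) (by decide +kernel)
        (n := 8) (countPoints_eq_of_fast (by decide +kernel)))
      (by decide) (by decide +kernel)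
  have hlow : MissingLowerBoundAt W 7 :=
    X6RankZero.missingLowerBoundAt_cell_130798a1_at7_LT hKim hGZK hmod' hWeq hr0 hkt D hc hper ψ hψ₁ hψ₂ hδ
  exact bsdp_of_missingPPartAt W 7 hGZK (by omega)
    (missingPPartAt_of_lower_of_upper W 7 hlow
      (X6.missingUpperBoundAt_rankZero_of_thm41 W 7 h41 h12 hKim315 hϖ h3 hmod hmod' hGZK (by norm_num) hX hr0))

end Summit.BirchSwinnertonDyer.BirchSwinnertonDyer.Theorems.PrintX6

end
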